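import Summits.Ventures.Crystal3D.Theorems.StickyWulffConstantCoaxialWallLawEndRowCoaxialModuleDefs
import Summits.Ventures.Crystal3D.Theorems.StickyWulffConstantCoaxialWallLawBarlowWindowFrames
import HarnessLib

/-!
# The eighteen-vector neighbour menu on COAXIAL MODULE windows (census-free)

HONEST FRAMING. Venture `Summits/Ventures/Crystal3D` (cell `crystal3d-full`), helper `--supports` the crux
`CoaxialWallLaw` (stmt-Ventures-19481, `route-Ventures-StickyWulffConstant`), REGISTERED line `WallLedgerF`, open stub
`stub_coaxialTwoSlabAdhesion`.  Rung credit only; F-C1 not moved.  cf-p1 DECISION (lxii) (2026-08-29): the non-Barlow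
coaxial universe of record is `coaxialModuleUniverse` (𝒰_cx, `…EndRowCoaxialModuleDefs`); the re-based bridge needs the
module form of `barlow_neighbour_mem` (`…BarlowWindowFrames`): two module points at distance `1` differ by a vector of
`D₊ = fccSlots` or of `D₋ = basalMirror '' fccSlots`.  This file proves it (19481-p1 g13).

* `twelve_mul_dist_sq_module` — for `x = i•u + j•v + n•w + k•h e₃`, `y = i'•u + …` on `coaxialModule 1 √(2/3)`:
  `12 · dist(x,y)² = 3(2P+Q+R)² + (3Q+R)² + 8K²` with `(P,Q,R,K) = (i'−i, j'−j, n'−n, k'−k)` (the form of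
  `twelve_mul_dist_barlowPos_sq` with a FREE letter difference `R`);
* `coaxialModule_neighbour_mem` — `dist x y = 1 ⇒ y − x ∈ fccSlots ∨ y − x ∈ basalMirror '' fccSlots`
  (Diophantine split: `K = 0` forces `R ≡ 0 (mod 3)` — an in-layer lattice vector, six cases; `K = ±1` forces
  `R ≡ ±1` — a hole vector, the up/down triples of `D₊` or of `D₋`);
* note: module points CAN be closer than `1` (hole neighbours at `1/√3`, vertical pairs at `√(2/3)`) — 𝒰_cx carries
  `1`-separation as a hypothesis; nothing about shorter distances is claimed here.
WHAT THIS IS NOT: not the frame lemma / domination on module windows (19481-p2's re-base), not a census fact; F-C1 not moved.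
-/

noncomputable section

namespace Summit.Ventures.Crystal3D.Theorems

open Summit.Ventures.Crystal3D Finset
open Literature.MathematicalPhysics.StatisticalMechanics (barlowPos barlowStacking constHagg haggLabel haggLabel_const
  triangularVec₁ triangularVec₂ barlowOffset layerNormal basalMirror basalMirror_barlowPos_constHagg three_smul_barlowOffset
  sixOffsets threeOffsets mem_sixOffsets_iff mem_threeOffsets_iff)
open scoped InnerProductSpace

/-! ### Coordinates and the distance form -/

/-- Coordinates of a module vector (`a = 1`, `h = √(2/3)`). -/
theorem moduleVec_apply (i j n k : ℤ) (t : Fin 3) :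
    ((i : ℝ) • triangularVec₁ 1 + (j : ℝ) • triangularVec₂ 1 + (n : ℝ) • barlowOffset 1 +
        (k : ℝ) • layerNormal (Real.sqrt (2 / 3))) t =
      if t = 0 then (i : ℝ) + j / 2 + n / 2 else if t = 1 then Real.sqrt 3 / 2 * (j + n / 3) else k * Real.sqrt (2 / 3) := by
  fin_cases t <;> simp [triangularVec₁, triangularVec₂, barlowOffset, layerNormal] <;> ring

/-- **The distance form on the module**: `12 · dist² = 3(2P+Q+R)² + (3Q+R)² + 8K²`. -/
theorem twelve_mul_dist_sq_module (i j n k i' j' n' k' : ℤ) :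
    12 * dist ((i : ℝ) • triangularVec₁ 1 + (j : ℝ) • triangularVec₂ 1 + (n : ℝ) • barlowOffset 1 +
          (k : ℝ) • layerNormal (Real.sqrt (2 / 3)))
        ((i' : ℝ) • triangularVec₁ 1 + (j' : ℝ) • triangularVec₂ 1 + (n' : ℝ) • barlowOffset 1 +
          (k' : ℝ) • layerNormal (Real.sqrt (2 / 3))) ^ 2 =
      ((3 * (2 * (i' - i) + (j' - j) + (n' - n)) ^ 2 + (3 * (j' - j) + (n' - n)) ^ 2 + 8 * (k' - k) ^ 2 : ℤ) : ℝ) := by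
  rw [EuclideanSpace.dist_eq, Real.sq_sqrt (Finset.sum_nonneg fun _ _ => sq_nonneg _), Fin.sum_univ_three,
    Real.dist_eq, Real.dist_eq, Real.dist_eq, sq_abs, sq_abs, sq_abs]
  simp only [moduleVec_apply]
  have h3 : Real.sqrt 3 ^ 2 = 3 := Real.sq_sqrt (by norm_num)
  have h23 : Real.sqrt (2 / 3) ^ 2 = 2 / 3 := Real.sq_sqrt (by norm_num)
  simp only [Fin.isValue, if_true, show (1 : Fin 3) ≠ 0 by decide, show (2 : Fin 3) ≠ 0 by decide,
    show (2 : Fin 3) ≠ 1 by decide, if_false]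
  push_cast
  linear_combination (3 * ((j : ℝ) + n / 3 - (j' + n' / 3)) ^ 2) * h3 + 12 * ((k : ℝ) - k') ^ 2 * h23

/-! ### The finite tables -/

/-- In-layer unit vectors are slots of `D₊` (layer `0` of the model fcc lattice). -/
theorem sixOffsets_mem_fccSlotTriples : ∀ PQ ∈ sixOffsets, ((0 : ℤ), PQ.1, PQ.2) ∈ fccSlotTriples := by decide

/-- Upper hole vectors of letter shift `+1` are the up-slots of `D₊`. -/
theorem threeOffsets_one_mem_fccSlotTriples : ∀ PQ ∈ threeOffsets 1, ((1 : ℤ), PQ.1, PQ.2) ∈ fccSlotTriples := by decide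

/-- Lower hole vectors of letter shift `−1` are the down-slots of `D₊`. -/
theorem threeOffsets_neg_one_mem_fccSlotTriples :
    ∀ PQ ∈ threeOffsets (-1), ((-1 : ℤ), PQ.1, PQ.2) ∈ fccSlotTriples := by decide

/-! ### The Diophantine split -/

/-- `3X² + Y² + 8K² = 12` forces `K ∈ {−1, 0, 1}`. -/
theorem sq_le_one_of_form {X Y K : ℤ} (h : 3 * X ^ 2 + Y ^ 2 + 8 * K ^ 2 = 12) : K = -1 ∨ K = 0 ∨ K = 1 := by
  have hK : K ^ 2 ≤ 1 := by nlinarith [sq_nonneg X, sq_nonneg Y]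
  obtain ⟨h1, h2⟩ := Literature.MathematicalPhysics.StatisticalMechanics.abs_le_one_of_sq_le_one hK
  omega

/-- In-layer case: `3X² + Y² = 12` forces `Y ∈ {−3, 0, 3}`. -/
theorem inLayer_cases {X Y : ℤ} (h : 3 * X ^ 2 + Y ^ 2 = 12) : Y = -3 ∨ Y = 0 ∨ Y = 3 := by
  have hX : X ^ 2 ≤ 4 := by nlinarith [sq_nonneg Y]
  have hY : Y ^ 2 ≤ 12 := by nlinarith [sq_nonneg X]
  obtain ⟨h1, h2⟩ := Literature.MathematicalPhysics.StatisticalMechanics.abs_le_two_of_sq_le_four hX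
  have hY4 : Y ^ 2 ≤ 16 := by linarith
  have h3 : -4 ≤ Y := by nlinarith
  have h4 : Y ≤ 4 := by nlinarith
  interval_cases X <;> interval_cases Y <;> omega

/-- Adjacent-layer case: `3X² + Y² = 4` forces `Y ∈ {−2, −1, 1, 2}`. -/
theorem adjLayer_cases {X Y : ℤ} (h : 3 * X ^ 2 + Y ^ 2 = 4) : Y = -2 ∨ Y = -1 ∨ Y = 1 ∨ Y = 2 := by
  have hX : X ^ 2 ≤ 1 := by nlinarith [sq_nonneg Y]
  obtain ⟨h1, h2⟩ := Literature.MathematicalPhysics.StatisticalMechanics.abs_le_one_of_sq_le_one hX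
  have hY : Y ^ 2 ≤ 4 := by nlinarith [sq_nonneg X]
  obtain ⟨h3, h4⟩ := Literature.MathematicalPhysics.StatisticalMechanics.abs_le_two_of_sq_le_four hY
  interval_cases X <;> interval_cases Y <;> omega

/-! ### The five shapes of a unit module vector -/

section Shapes

/-- `3t • w = t • u + t • v` (cast form). -/
theorem smul_barlowOffset_three (t : ℤ) :
    ((3 * t : ℤ) : ℝ) • barlowOffset 1 = (t : ℝ) • triangularVec₁ 1 + (t : ℝ) • triangularVec₂ 1 := by
  have h := three_smul_barlowOffset (a := (1 : ℝ))
  push_cast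
  rw [mul_comm, mul_smul, h, smul_add]

/-- `(3t + 1) • w = t • u + t • v + w`. -/
theorem smul_barlowOffset_three_add_one (t : ℤ) :
    ((3 * t + 1 : ℤ) : ℝ) • barlowOffset 1 = (t : ℝ) • triangularVec₁ 1 + (t : ℝ) • triangularVec₂ 1 + barlowOffset 1 := by
  rw [Int.cast_add, add_smul, smul_barlowOffset_three, Int.cast_one, one_smul]

/-- `(3t − 1) • w = t • u + t • v − w`. -/
theorem smul_barlowOffset_three_sub_one (t : ℤ) :
    ((3 * t - 1 : ℤ) : ℝ) • barlowOffset 1 = (t : ℝ) • triangularVec₁ 1 + (t : ℝ) • triangularVec₂ 1 - barlowOffset 1 := by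
  rw [Int.cast_sub, sub_smul, smul_barlowOffset_three, Int.cast_one, one_smul]

/-- In-layer shape: `P u + Q v + 3t w` with `(P+t, Q+t) ∈ sixOffsets` is a slot of `D₊`. -/
theorem inLayer_mem_fccSlots {P Q t : ℤ} (h : (P + t, Q + t) ∈ sixOffsets) :
    ((P : ℝ) • triangularVec₁ 1 + (Q : ℝ) • triangularVec₂ 1 + ((3 * t : ℤ) : ℝ) • barlowOffset 1 +
        ((0 : ℤ) : ℝ) • layerNormal (Real.sqrt (2 / 3))) ∈ fccSlots := by
  have hmem := barlowPos_mem_fccSlots (sixOffsets_mem_fccSlotTriples _ h)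
  rw [barlowPos_constHagg_eq] at hmem
  convert hmem using 1
  rw [smul_barlowOffset_three]; push_cast; module

/-- Up shape: `P u + Q v + (3t+1) w + N` with `(P+t, Q+t) ∈ threeOffsets 1` is an up-slot of `D₊`. -/
theorem up_mem_fccSlots {P Q t : ℤ} (h : (P + t, Q + t) ∈ threeOffsets 1) :
    ((P : ℝ) • triangularVec₁ 1 + (Q : ℝ) • triangularVec₂ 1 + ((3 * t + 1 : ℤ) : ℝ) • barlowOffset 1 +
        ((1 : ℤ) : ℝ) • layerNormal (Real.sqrt (2 / 3))) ∈ fccSlots := by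
  have hmem := barlowPos_mem_fccSlots (threeOffsets_one_mem_fccSlotTriples _ h)
  rw [barlowPos_constHagg_eq] at hmem
  convert hmem using 1
  rw [smul_barlowOffset_three_add_one]; push_cast; module

/-- Down shape: `P u + Q v + (3t−1) w − N` with `(P+t, Q+t) ∈ threeOffsets (−1)` is a down-slot of `D₊`. -/
theorem down_mem_fccSlots {P Q t : ℤ} (h : (P + t, Q + t) ∈ threeOffsets (-1)) :
    ((P : ℝ) • triangularVec₁ 1 + (Q : ℝ) • triangularVec₂ 1 + ((3 * t - 1 : ℤ) : ℝ) • barlowOffset 1 +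
        ((-1 : ℤ) : ℝ) • layerNormal (Real.sqrt (2 / 3))) ∈ fccSlots := by
  have hmem := barlowPos_mem_fccSlots (threeOffsets_neg_one_mem_fccSlotTriples _ h)
  rw [barlowPos_constHagg_eq] at hmem
  convert hmem using 1
  rw [smul_barlowOffset_three_sub_one]; push_cast; module

/-- Mirror-up shape: `P u + Q v + (3t−1) w + N` with `(P+t, Q+t) ∈ threeOffsets (−1)` is the basal mirror of a down-slot. -/
theorem upMirror_mem {P Q t : ℤ} (h : (P + t, Q + t) ∈ threeOffsets (-1)) :
    ((P : ℝ) • triangularVec₁ 1 + (Q : ℝ) • triangularVec₂ 1 + ((3 * t - 1 : ℤ) : ℝ) • barlowOffset 1 +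
        ((1 : ℤ) : ℝ) • layerNormal (Real.sqrt (2 / 3))) ∈
      (basalMirror : EuclideanSpace ℝ (Fin 3) → EuclideanSpace ℝ (Fin 3)) '' ↑fccSlots := by
  refine ⟨barlowPos 1 (Real.sqrt (2 / 3)) constHagg (-1) (P + t) (Q + t),
    mem_coe.2 (barlowPos_mem_fccSlots (threeOffsets_neg_one_mem_fccSlotTriples _ h)), ?_⟩
  rw [basalMirror_barlowPos_constHagg, smul_barlowOffset_three_sub_one]; push_cast; module

/-- Mirror-down shape: `P u + Q v + (3t+1) w − N` with `(P+t, Q+t) ∈ threeOffsets 1` is the basal mirror of an up-slot. -/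
theorem downMirror_mem {P Q t : ℤ} (h : (P + t, Q + t) ∈ threeOffsets 1) :
    ((P : ℝ) • triangularVec₁ 1 + (Q : ℝ) • triangularVec₂ 1 + ((3 * t + 1 : ℤ) : ℝ) • barlowOffset 1 +
        ((-1 : ℤ) : ℝ) • layerNormal (Real.sqrt (2 / 3))) ∈
      (basalMirror : EuclideanSpace ℝ (Fin 3) → EuclideanSpace ℝ (Fin 3)) '' ↑fccSlots := by
  refine ⟨barlowPos 1 (Real.sqrt (2 / 3)) constHagg 1 (P + t) (Q + t),
    mem_coe.2 (barlowPos_mem_fccSlots (threeOffsets_one_mem_fccSlotTriples _ h)), ?_⟩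
  rw [basalMirror_barlowPos_constHagg, smul_barlowOffset_three_add_one]; push_cast; module

end Shapes

/-! ### The neighbour menu -/

/-- **NEIGHBOUR MENU ON THE COAXIAL MODULE.**  Two points of `coaxialModule 1 √(2/3)` at distance `1` differ by a vector
of `D₊ = fccSlots` or of `D₋ = basalMirror '' fccSlots`. -/
theorem coaxialModule_neighbour_mem {x y : EuclideanSpace ℝ (Fin 3)} (hx : x ∈ coaxialModule 1 (Real.sqrt (2 / 3)))
    (hy : y ∈ coaxialModule 1 (Real.sqrt (2 / 3))) (hd : dist x y = 1) :
    y - x ∈ fccSlots ∨ y - x ∈ (basalMirror : EuclideanSpace ℝ (Fin 3) → EuclideanSpace ℝ (Fin 3)) '' ↑fccSlots := by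
  obtain ⟨i, j, n, k, rfl⟩ := hx
  obtain ⟨i', j', n', k', rfl⟩ := hy
  have hform : 3 * (2 * (i' - i) + (j' - j) + (n' - n)) ^ 2 + (3 * (j' - j) + (n' - n)) ^ 2 + 8 * (k' - k) ^ 2 = 12 := by
    have h12 := twelve_mul_dist_sq_module i j n k i' j' n' k'
    rw [hd, one_pow, mul_one] at h12
    exact_mod_cast h12.symm
  have hdiff : ((i' : ℝ) • triangularVec₁ 1 + (j' : ℝ) • triangularVec₂ 1 + (n' : ℝ) • barlowOffset 1 +
        (k' : ℝ) • layerNormal (Real.sqrt (2 / 3))) -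
      ((i : ℝ) • triangularVec₁ 1 + (j : ℝ) • triangularVec₂ 1 + (n : ℝ) • barlowOffset 1 +
        (k : ℝ) • layerNormal (Real.sqrt (2 / 3))) =
      ((i' - i : ℤ) : ℝ) • triangularVec₁ 1 + ((j' - j : ℤ) : ℝ) • triangularVec₂ 1 +
        ((n' - n : ℤ) : ℝ) • barlowOffset 1 + ((k' - k : ℤ) : ℝ) • layerNormal (Real.sqrt (2 / 3)) := by
    push_cast; module
  rw [hdiff]
  generalize i' - i = P at hform ⊢
  generalize j' - j = Q at hform ⊢
  generalize n' - n = R at hform ⊢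
  generalize k' - k = K at hform ⊢
  rcases sq_le_one_of_form hform with rfl | rfl | rfl
  · -- K = −1 : layer below
    have h4 : 3 * (2 * P + Q + R) ^ 2 + (3 * Q + R) ^ 2 = 4 := by linarith
    rcases adjLayer_cases h4 with hY | hY | hY | hY
    · obtain ⟨t, rfl⟩ : ∃ t, R = 3 * t + 1 := ⟨-Q - 1, by omega⟩
      exact Or.inr (downMirror_mem ((mem_threeOffsets_iff (Or.inl rfl)).2 (by linarith [h4])))
    · obtain ⟨t, rfl⟩ : ∃ t, R = 3 * t - 1 := ⟨-Q, by omega⟩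
      exact Or.inl (down_mem_fccSlots ((mem_threeOffsets_iff (Or.inr rfl)).2 (by linarith [h4])))
    · obtain ⟨t, rfl⟩ : ∃ t, R = 3 * t + 1 := ⟨-Q, by omega⟩
      exact Or.inr (downMirror_mem ((mem_threeOffsets_iff (Or.inl rfl)).2 (by linarith [h4])))
    · obtain ⟨t, rfl⟩ : ∃ t, R = 3 * t - 1 := ⟨1 - Q, by omega⟩
      exact Or.inl (down_mem_fccSlots ((mem_threeOffsets_iff (Or.inr rfl)).2 (by linarith [h4])))
  · -- K = 0 : in-layer
    have h12 : 3 * (2 * P + Q + R) ^ 2 + (3 * Q + R) ^ 2 = 12 := by linarith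
    obtain ⟨t, rfl⟩ : ∃ t, R = 3 * t := by
      rcases inLayer_cases h12 with hY | hY | hY
      · exact ⟨-1 - Q, by omega⟩
      · exact ⟨-Q, by omega⟩
      · exact ⟨1 - Q, by omega⟩
    exact Or.inl (inLayer_mem_fccSlots (mem_sixOffsets_iff.2 (by linarith [h12])))
  · -- K = 1 : layer above
    have h4 : 3 * (2 * P + Q + R) ^ 2 + (3 * Q + R) ^ 2 = 4 := by linarith
    rcases adjLayer_cases h4 with hY | hY | hY | hY
    · obtain ⟨t, rfl⟩ : ∃ t, R = 3 * t + 1 := ⟨-Q - 1, by omega⟩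
      exact Or.inl (up_mem_fccSlots ((mem_threeOffsets_iff (Or.inl rfl)).2 (by linarith [h4])))
    · obtain ⟨t, rfl⟩ : ∃ t, R = 3 * t - 1 := ⟨-Q, by omega⟩
      exact Or.inr (upMirror_mem ((mem_threeOffsets_iff (Or.inr rfl)).2 (by linarith [h4])))
    · obtain ⟨t, rfl⟩ : ∃ t, R = 3 * t + 1 := ⟨-Q, by omega⟩
      exact Or.inl (up_mem_fccSlots ((mem_threeOffsets_iff (Or.inl rfl)).2 (by linarith [h4])))
    · obtain ⟨t, rfl⟩ : ∃ t, R = 3 * t - 1 := ⟨1 - Q, by omega⟩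
      exact Or.inr (upMirror_mem ((mem_threeOffsets_iff (Or.inr rfl)).2 (by linarith [h4])))

end Summit.Ventures.Crystal3D.Theorems

end
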